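import Summits.QuantumFields.GaugeBoot.Rows.KZL2rpD3LTab
import HarnessLib

/-!
# Gauge-boot: kernel check of the raw `link1` class table of the kz-L2-rp-3D problems, rows 63–99 (part 3/6)

Cell `pub-gaugeboot` (HOME `run/shared/lean/pub/pub-gaugeboot/`), seat lean1 (torus positivity layer for rows C15–C19, C34–C40 (+ the w1x2 / w1x3 / w2x2 windows of the same family) =
the certified kz-L2-rp-3D windows: label set, reflection lines, class/witness tables, the reduction identity; Hermitian half transported from `KZL2HD3`).

HONEST FRAMING (page 1 of every file of this cell): certified bounds on lattice expectations at STATED coupling,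
gauge group, dimension and torus size; NOT a mass gap, NOT a continuum limit, NOT a string tension, NOT large `N`.
The venture is explicitly NOT Yang–Mills-summit-bearing (barriers `FixedCouplingUltralocality`,
`PerturbativeInvisibility`).

`lcanon_rows_<lo>_<hi> : ∀ i, lo ≤ i < hi → ∀ j ≥ i, KZL2rpD3.LCanonOK i j`, each range one closed computation (`decide +kernel`,
≤ 900 entries per theorem — farm calibration for D = 3 reflection words); assembled in `KZL2rpD3Red`.
-/

noncomputable section

open Literature.MathematicalPhysics.QuantumFieldTheory

namespace Summit.QuantumFields.GaugeBoot

namespace KZL2rpD3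

set_option maxHeartbeats 0 in
/-- Rows `63 ≤ i < 67` of the `link1` class table of the kz-L2-rp-3D problems canonicalise (946 entries; kernel). -/
theorem lcanon_rows_63_67 : ∀ i : Fin 301, 63 ≤ i.val → i.val < 67 → ∀ j : Fin 301, i.val ≤ j.val → KZL2rpD3.LCanonOK i j := by
  decide +kernel

set_option maxHeartbeats 0 in
/-- Rows `67 ≤ i < 71` of the `link1` class table of the kz-L2-rp-3D problems canonicalise (930 entries; kernel). -/
theorem lcanon_rows_67_71 : ∀ i : Fin 301, 67 ≤ i.val → i.val < 71 → ∀ j : Fin 301, i.val ≤ j.val → KZL2rpD3.LCanonOK i j := by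
  decide +kernel

set_option maxHeartbeats 0 in
/-- Rows `71 ≤ i < 75` of the `link1` class table of the kz-L2-rp-3D problems canonicalise (914 entries; kernel). -/
theorem lcanon_rows_71_75 : ∀ i : Fin 301, 71 ≤ i.val → i.val < 75 → ∀ j : Fin 301, i.val ≤ j.val → KZL2rpD3.LCanonOK i j := by
  decide +kernel

set_option maxHeartbeats 0 in
/-- Rows `75 ≤ i < 80` of the `link1` class table of the kz-L2-rp-3D problems canonicalise (1120 entries; kernel). -/
theorem lcanon_rows_75_80 : ∀ i : Fin 301, 75 ≤ i.val → i.val < 80 → ∀ j : Fin 301, i.val ≤ j.val → KZL2rpD3.LCanonOK i j := by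
  decide +kernel

set_option maxHeartbeats 0 in
/-- Rows `80 ≤ i < 85` of the `link1` class table of the kz-L2-rp-3D problems canonicalise (1095 entries; kernel). -/
theorem lcanon_rows_80_85 : ∀ i : Fin 301, 80 ≤ i.val → i.val < 85 → ∀ j : Fin 301, i.val ≤ j.val → KZL2rpD3.LCanonOK i j := by
  decide +kernel

set_option maxHeartbeats 0 in
/-- Rows `85 ≤ i < 90` of the `link1` class table of the kz-L2-rp-3D problems canonicalise (1070 entries; kernel). -/
theorem lcanon_rows_85_90 : ∀ i : Fin 301, 85 ≤ i.val → i.val < 90 → ∀ j : Fin 301, i.val ≤ j.val → KZL2rpD3.LCanonOK i j := by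
  decide +kernel

set_option maxHeartbeats 0 in
/-- Rows `90 ≤ i < 95` of the `link1` class table of the kz-L2-rp-3D problems canonicalise (1045 entries; kernel). -/
theorem lcanon_rows_90_95 : ∀ i : Fin 301, 90 ≤ i.val → i.val < 95 → ∀ j : Fin 301, i.val ≤ j.val → KZL2rpD3.LCanonOK i j := by
  decide +kernel

set_option maxHeartbeats 0 in
/-- Rows `95 ≤ i < 100` of the `link1` class table of the kz-L2-rp-3D problems canonicalise (1020 entries; kernel). -/
theorem lcanon_rows_95_100 : ∀ i : Fin 301, 95 ≤ i.val → i.val < 100 → ∀ j : Fin 301, i.val ≤ j.val → KZL2rpD3.LCanonOK i j := by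
  decide +kernel

end KZL2rpD3

end Summit.QuantumFields.GaugeBoot

end
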